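import Literature.Analysis.FluidPDE.NewtonKernel
import Literature.Analysis.FluidPDE.RieszKernelBounds
import Mathlib.Analysis.SpecialFunctions.JapaneseBracket
import Literature.Geometry.Lorentzian.Basic
import HarnessLib

/-!
# Far-field (monopole) expansion of the Newtonian potential of a decaying density on `ℝ³`

For a density `G : ℝ³ → ℝ` that is **not** compactly supported but decays like `|y|⁻⁴`, the
Newtonian potential `∫ G(y)/|x - y| dy` still has the monopole expansion

  `∫ G(y)/|x - y| dy = (∫ G)/|x| + O(|x|⁻²)`   (`|x| → ∞`),

*provided the truncated first moments `∫_{|y| < ρ} G(y) y dy` stay bounded*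
(`integral_inv_norm_sub_mul_sub_isBigO`; Newtonian-kernel form `Γ(z) = -(4π|z|)⁻¹` in
`integral_newtonKernel_mul_sub_isBigO`). The moment hypothesis is automatic for decay
`|G| ≤ K(1 + |y|)^{-q}`, `q > 4` (`integral_inv_norm_sub_mul_sub_isBigO_of_decay`), and may be
tested against the smooth radial cutoffs `radialCutoff ρ (2ρ)` of `FluidPDE/NewtonKernel.lean`
instead of sharp balls (`integral_inv_norm_sub_mul_sub_isBigO_of_radialCutoff`,
`norm_setIntegral_smul_le_of_radialCutoff`), which is the convenient form when the moments are
controlled by integration by parts. Without any moment hypothesis the potential is still `O(1/|x|)`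
(`norm_integral_inv_norm_sub_mul_le`, `integral_inv_norm_sub_mul_isBigO_inv_norm`; the flat form
of Schoen–Yau's supremum bound (3.9)). In the expansion the moment hypothesis cannot be dropped: for `G = O(|y|⁻⁴)` alone the dipole
term `⟨x, ∫_{|y|<|x|/2} G(y) y dy⟩/|x|³` can be of size `|x|⁻² log |x|` (e.g. `G(y) = y₁|y|⁻⁵` off
the unit ball, whose potential is `c (log |x|) x₁/|x|³ + O(|x|⁻²)`).

This extends `Literature.Geometry.Lorentzian.newtonPotential_sub_isBigO`
(`HarmonicallyFlatProofs.lean`: continuous densities of compact support) to the densities met in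
the asymptotic analysis on an asymptotically flat end, where sources decay like the scalar
curvature, `R = O(r⁻⁴)`. It is the flat-kernel form of the estimates behind Schoen–Yau's expansion
`v = A/r + ω`, `A = -(1/4π) ∫ (fv + h)`, `|ω| ≤ k₁₁ (1 + r²)⁻¹` for solutions of `Δv - fv = h`
with `|f| + |h| = O(r⁻⁴)` (Comm. Math. Phys. 65 (1979), Lemma 3.2, (3.12)–(3.18): "the following
inequalities are easily checked"); for the source `h = R/8` of their (3.23) the moment hypothesis
holds because the `r⁻⁴` part of `R` is in divergence form, `∂ᵢ(∂ⱼgᵢⱼ - ∂ᵢgⱼⱼ)`.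

## The proof

For `|x| = r ≥ 2` write `∫ G/|x - y| - (∫ G)/r = ∫ (1/|x - y| - 1/r) G` and split at `|y| = r/2`.

* *Near region* `|y| < r/2` (`norm_integral_near_le`): the kernel difference is the dipole term
  plus a remainder, `|1/|x - y| - 1/|x| - ⟨x, y⟩/|x|³| ≤ 6|y|²/|x|³`
  (`abs_inv_norm_sub_sub_inv_norm_sub_inner_le`, from the identity
  `1/s - 1/r - i/r³ = (i(r - s)(2r + s) - n r²)/(r³ s (r + s))`, `s² = r² - 2i + n`); the dipole term
  integrates to `⟨x, ∫_{|y|<r/2} G y⟩/r³ = O(K'/r²)`, the remainder against `|G| ≤ K|y|⁻⁴` to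
  `6K r⁻³ ∫_{|y|<r/2} |y|⁻² = 3Kc₂/r²`.
* *Far region* `|y| ≥ r/2` (`norm_integral_far_le`): on `|x - y| < r/2` one has `|G| ≤ 16K r⁻⁴` and
  `∫_{|x-y|<r/2} |x - y|⁻¹ = c₁ r²/4`; elsewhere the kernel difference is at most `3/r` against
  `∫_{|y| ≥ r/2} K|y|⁻⁴ = 2Kc₄/r`.

The radial integrals are obtained by scaling from the unit ball (`setLIntegral_ball_powKer_eq`,
`setLIntegral_compl_ball_powKer_eq`, with the kernels `powKer s = |·|^{-s}` of
`FluidPDE/RieszKernelBounds.lean`); only the finiteness of `c₁ = ∫_{B₁}|u|⁻¹`, `c₂ = ∫_{B₁}|u|⁻²`,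
`c₄ = ∫_{B₁ᶜ}|u|⁻⁴` is used (they are `2π, 4π, 4π`), and the error integrals are estimated as
lower Lebesgue integrals, so that no integrability bookkeeping is needed for them. All results are
proved; nothing is defined and no named fact is introduced.

## References

* R. Schoen, S.-T. Yau, *On the proof of the positive mass conjecture in general relativity*,
  Comm. Math. Phys. 65 (1979) 45–76, Lemma 3.2, (3.12)–(3.18) (pp. 67–69). [SchoenYauPMT1979]
* D. Gilbarg, N. S. Trudinger, *Elliptic partial differential equations of second order* (2001),
  §2.4 (Newtonian kernel), §4.1.
-/

noncomputable section

open MeasureTheory Set Filter Topology Real Metric Asymptotics Bornology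
open scoped ENNReal InnerProductSpace

namespace Literature.Analysis.Potential

open Literature.Analysis.FluidPDE Literature.Analysis.FluidPDE.RieszKernel
open Literature.Geometry.Lorentzian (E3)

/-! ### Kernel algebra: the multipole expansion of `1/|x - y|` to second order -/

/-- For `|y| ≤ |x|/2` the distance `|x - y|` is pinched: `|x|/2 ≤ |x - y| ≤ 3|x|/2`. [folklore] -/
theorem norm_sub_bounds {x y : E3} (hy : ‖y‖ ≤ ‖x‖ / 2) :
    ‖x‖ / 2 ≤ ‖x - y‖ ∧ ‖x - y‖ ≤ 3 * ‖x‖ / 2 := by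
  constructor
  · have := norm_sub_norm_le x y
    have h2 : ‖x‖ - ‖y‖ ≤ ‖x - y‖ := by
      have := norm_le_norm_add_norm_sub' x y
      have := norm_sub_le x y
      nlinarith [norm_le_insert' x y, norm_sub_norm_le x (x - y)]
    linarith
  · have := norm_sub_le x y
    linarith

/-- **First-order bound**: for `|y| ≤ |x|/2`, `x ≠ 0`,
`|1/|x - y| - 1/|x|| ≤ 2|y|/|x|²`. [folklore] -/
theorem abs_inv_norm_sub_sub_inv_norm_le {x y : E3} (hx : x ≠ 0) (hy : ‖y‖ ≤ ‖x‖ / 2) :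
    |‖x - y‖⁻¹ - ‖x‖⁻¹| ≤ 2 * ‖y‖ / ‖x‖ ^ 2 := by
  have hr : 0 < ‖x‖ := norm_pos_iff.2 hx
  obtain ⟨hs1, hs2⟩ := norm_sub_bounds hy
  have hs : 0 < ‖x - y‖ := by linarith
  have hdiff : |‖x‖ - ‖x - y‖| ≤ ‖y‖ := by
    have := abs_norm_sub_norm_le x (x - y)
    rwa [sub_sub_cancel] at this
  rw [inv_sub_inv hs.ne' hr.ne', abs_div, abs_of_pos (mul_pos hs hr)]
  rw [div_le_div_iff₀ (mul_pos hs hr) (by positivity)]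
  calc |‖x‖ - ‖x - y‖| * ‖x‖ ^ 2 ≤ ‖y‖ * ‖x‖ ^ 2 := by gcongr
    _ = 2 * ‖y‖ * (‖x‖ / 2 * ‖x‖) := by ring
    _ ≤ 2 * ‖y‖ * (‖x - y‖ * ‖x‖) := by gcongr

/-- The algebraic identity behind the second-order expansion: with `r = |x|`, `s = |x - y|`,
`i = ⟨x, y⟩`, `n = |y|²` (so that `s² = r² - 2i + n`),
`1/s - 1/r - i/r³ = (i (r - s)(2r + s) - n r²) / (r³ s (r + s))`. [folklore] -/
theorem inv_sub_inv_sub_div_cube_eq {r s i n : ℝ} (hr : 0 < r) (hs : 0 < s)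
    (hsq : s ^ 2 = r ^ 2 - 2 * i + n) :
    s⁻¹ - r⁻¹ - i / r ^ 3 = (i * (r - s) * (2 * r + s) - n * r ^ 2) / (r ^ 3 * s * (r + s)) := by
  have hrs : 0 < r + s := by positivity
  rw [eq_div_iff (by positivity)]
  field_simp
  linear_combination (-(r ^ 2) + 0) * hsq + 0 * hsq

/-- **Second-order bound** (the dipole term isolated): for `|y| ≤ |x|/2`, `x ≠ 0`,
`|1/|x - y| - 1/|x| - ⟨x, y⟩/|x|³| ≤ 6|y|²/|x|³`. [folklore] -/
theorem abs_inv_norm_sub_sub_inv_norm_sub_inner_le {x y : E3} (hx : x ≠ 0) (hy : ‖y‖ ≤ ‖x‖ / 2) :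
    |‖x - y‖⁻¹ - ‖x‖⁻¹ - ⟪x, y⟫_ℝ / ‖x‖ ^ 3| ≤ 6 * ‖y‖ ^ 2 / ‖x‖ ^ 3 := by
  have hr : 0 < ‖x‖ := norm_pos_iff.2 hx
  obtain ⟨hs1, hs2⟩ := norm_sub_bounds hy
  have hs : 0 < ‖x - y‖ := by linarith
  set r := ‖x‖ with hrdef
  set s := ‖x - y‖ with hsdef
  set i := ⟪x, y⟫_ℝ with hidef
  set n := ‖y‖ ^ 2 with hndef
  have hsq : s ^ 2 = r ^ 2 - 2 * i + n := by
    rw [hsdef, hrdef, hidef, hndef, @norm_sub_sq_real]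
  have hdiff : |r - s| ≤ ‖y‖ := by
    have := abs_norm_sub_norm_le x (x - y)
    rwa [sub_sub_cancel] at this
  have hi : |i| ≤ r * ‖y‖ := by
    rw [hidef, hrdef]; exact abs_real_inner_le_norm x y
  rw [inv_sub_inv_sub_div_cube_eq hr hs hsq, abs_div,
    abs_of_pos (by positivity : (0:ℝ) < r ^ 3 * s * (r + s)),
    div_le_div_iff₀ (by positivity) (by positivity)]
  have hnum : |i * (r - s) * (2 * r + s) - n * r ^ 2| ≤
      r * ‖y‖ * ‖y‖ * (2 * r + s) + n * r ^ 2 := by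
    refine (abs_sub _ _).trans ?_
    gcongr
    · rw [abs_mul, abs_mul, abs_of_pos (by positivity : (0:ℝ) < 2 * r + s)]
      gcongr
    · rw [abs_of_nonneg (by positivity)]
  have hy0 : 0 ≤ ‖y‖ := norm_nonneg _
  calc |i * (r - s) * (2 * r + s) - n * r ^ 2| * r ^ 3
      ≤ (r * ‖y‖ * ‖y‖ * (2 * r + s) + n * r ^ 2) * r ^ 3 := by gcongr
    _ = ‖y‖ ^ 2 * r ^ 3 * (r * (2 * r + s) + r ^ 2) := by rw [hndef]; ring
    _ ≤ ‖y‖ ^ 2 * r ^ 3 * (6 * (s * (r + s))) := by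
        gcongr ‖y‖ ^ 2 * r ^ 3 * ?_
        nlinarith
    _ = 6 * ‖y‖ ^ 2 * (r ^ 3 * s * (r + s)) := by ring

/-! ### Radial kernel integrals at scale `r` -/

/-- **Scaling of kernel integrals over balls**: `∫_{|z| < r} |z|^{-s} dz = r^{3-s} ∫_{|u| < 1} |u|^{-s} du`
for `r > 0`. [folklore] -/
theorem setLIntegral_ball_powKer_eq (s : ℝ) {r : ℝ} (hr : 0 < r) :
    ∫⁻ z in ball (0 : E3) r, powKer s z =
      ENNReal.ofReal (r ^ (3 - s)) * ∫⁻ u in ball (0 : E3) 1, powKer s u := by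
  have hr' : 0 < r⁻¹ := inv_pos.2 hr
  -- `f(u) = 1_{B₁}(u) |u|^{-s}`, so that `f(r⁻¹ z) = r^{s} 1_{B_r}(z) |z|^{-s}`
  have key := lintegral_comp_smul ((ball (0 : E3) 1).indicator (powKer s)) hr'
  have hind : ∀ z : E3, (ball (0 : E3) 1).indicator (powKer s) (r⁻¹ • z) =
      ENNReal.ofReal (r⁻¹ ^ (-s)) * (ball (0 : E3) r).indicator (powKer s) z := by
    intro z
    have hmem : r⁻¹ • z ∈ ball (0 : E3) 1 ↔ z ∈ ball (0 : E3) r := by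
      rw [mem_ball_zero_iff, mem_ball_zero_iff, norm_smul, Real.norm_eq_abs, abs_of_pos hr',
        inv_mul_lt_iff₀ hr, mul_one]
    by_cases hz : z ∈ ball (0 : E3) r
    · rw [indicator_of_mem (hmem.2 hz), indicator_of_mem hz, powKer_smul hr']
    · rw [indicator_of_notMem (fun h ↦ hz (hmem.1 h)), indicator_of_notMem hz, mul_zero]
  simp_rw [hind] at key
  rw [lintegral_const_mul' _ _ ENNReal.ofReal_ne_top, lintegral_indicator measurableSet_ball,
    lintegral_indicator measurableSet_ball] at key
  -- solve for the ball integral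
  have h1 : ENNReal.ofReal (r⁻¹ ^ (-s)) = ENNReal.ofReal (r ^ s) := by
    rw [Real.inv_rpow hr.le, Real.rpow_neg hr.le, inv_inv]
  have h2 : ENNReal.ofReal (r⁻¹ ^ 3)⁻¹ = ENNReal.ofReal (r ^ 3) := by
    rw [inv_pow, inv_inv]
  rw [h1, h2] at key
  have hrs : ENNReal.ofReal (r ^ s) ≠ 0 := by
    rw [ENNReal.ofReal_ne_zero_iff]; exact Real.rpow_pos_of_pos hr s
  calc ∫⁻ z in ball (0 : E3) r, powKer s z
      = (ENNReal.ofReal (r ^ s))⁻¹ * (ENNReal.ofReal (r ^ s) * ∫⁻ z in ball (0 : E3) r, powKer s z) := by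
        rw [← mul_assoc, ENNReal.inv_mul_cancel hrs ENNReal.ofReal_ne_top, one_mul]
    _ = (ENNReal.ofReal (r ^ s))⁻¹ * (ENNReal.ofReal (r ^ 3) * ∫⁻ u in ball (0 : E3) 1, powKer s u) := by
        rw [key]
    _ = ENNReal.ofReal (r ^ (3 - s)) * ∫⁻ u in ball (0 : E3) 1, powKer s u := by
        rw [← mul_assoc]
        congr 1
        rw [← ENNReal.ofReal_inv_of_pos (Real.rpow_pos_of_pos hr s), ← ENNReal.ofReal_mul (by positivity),
          Real.rpow_sub hr, show r ^ (3 : ℝ) = r ^ (3 : ℕ) by norm_cast]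
        congr 1
        field_simp

/-- **Scaling of kernel integrals off balls**:
`∫_{|z| ≥ r} |z|^{-s} dz = r^{3-s} ∫_{|u| ≥ 1} |u|^{-s} du` for `r > 0`. [folklore] -/
theorem setLIntegral_compl_ball_powKer_eq (s : ℝ) {r : ℝ} (hr : 0 < r) :
    ∫⁻ z in (ball (0 : E3) r)ᶜ, powKer s z =
      ENNReal.ofReal (r ^ (3 - s)) * ∫⁻ u in (ball (0 : E3) 1)ᶜ, powKer s u := by
  have hr' : 0 < r⁻¹ := inv_pos.2 hr
  have key := lintegral_comp_smul ((ball (0 : E3) 1)ᶜ.indicator (powKer s)) hr'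
  have hind : ∀ z : E3, (ball (0 : E3) 1)ᶜ.indicator (powKer s) (r⁻¹ • z) =
      ENNReal.ofReal (r⁻¹ ^ (-s)) * (ball (0 : E3) r)ᶜ.indicator (powKer s) z := by
    intro z
    have hmem : r⁻¹ • z ∈ (ball (0 : E3) 1)ᶜ ↔ z ∈ (ball (0 : E3) r)ᶜ := by
      rw [mem_compl_iff, mem_compl_iff, mem_ball_zero_iff, mem_ball_zero_iff, norm_smul,
        Real.norm_eq_abs, abs_of_pos hr', inv_mul_lt_iff₀ hr, mul_one]
    by_cases hz : z ∈ (ball (0 : E3) r)ᶜ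
    · rw [indicator_of_mem (hmem.2 hz), indicator_of_mem hz, powKer_smul hr']
    · rw [indicator_of_notMem (fun h ↦ hz (hmem.1 h)), indicator_of_notMem hz, mul_zero]
  simp_rw [hind] at key
  rw [lintegral_const_mul' _ _ ENNReal.ofReal_ne_top, lintegral_indicator measurableSet_ball.compl,
    lintegral_indicator measurableSet_ball.compl] at key
  have h1 : ENNReal.ofReal (r⁻¹ ^ (-s)) = ENNReal.ofReal (r ^ s) := by
    rw [Real.inv_rpow hr.le, Real.rpow_neg hr.le, inv_inv]
  have h2 : ENNReal.ofReal (r⁻¹ ^ 3)⁻¹ = ENNReal.ofReal (r ^ 3) := by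
    rw [inv_pow, inv_inv]
  rw [h1, h2] at key
  have hrs : ENNReal.ofReal (r ^ s) ≠ 0 := by
    rw [ENNReal.ofReal_ne_zero_iff]; exact Real.rpow_pos_of_pos hr s
  calc ∫⁻ z in (ball (0 : E3) r)ᶜ, powKer s z
      = (ENNReal.ofReal (r ^ s))⁻¹ * (ENNReal.ofReal (r ^ s) * ∫⁻ z in (ball (0 : E3) r)ᶜ, powKer s z) := by
        rw [← mul_assoc, ENNReal.inv_mul_cancel hrs ENNReal.ofReal_ne_top, one_mul]
    _ = (ENNReal.ofReal (r ^ s))⁻¹ * (ENNReal.ofReal (r ^ 3) * ∫⁻ u in (ball (0 : E3) 1)ᶜ, powKer s u) := by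
        rw [key]
    _ = ENNReal.ofReal (r ^ (3 - s)) * ∫⁻ u in (ball (0 : E3) 1)ᶜ, powKer s u := by
        rw [← mul_assoc]
        congr 1
        rw [← ENNReal.ofReal_inv_of_pos (Real.rpow_pos_of_pos hr s), ← ENNReal.ofReal_mul (by positivity),
          Real.rpow_sub hr, show r ^ (3 : ℝ) = r ^ (3 : ℕ) by norm_cast]
        congr 1
        field_simp

/-- The three radial constants of the far-field estimate: `∫_{B₁} |u|⁻¹`, `∫_{B₁} |u|⁻²` and
`∫_{B₁ᶜ} |u|⁻⁴` are finite. [folklore] -/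
theorem radialConst_lt_top :
    ∫⁻ u in ball (0 : E3) 1, powKer 1 u < ⊤ ∧ ∫⁻ u in ball (0 : E3) 1, powKer 2 u < ⊤ ∧
      ∫⁻ u in (ball (0 : E3) 1)ᶜ, powKer 4 u < ⊤ :=
  ⟨lintegral_ball_powKer_lt_top (by norm_num) 1, lintegral_ball_powKer_lt_top (by norm_num) 1,
    lintegral_compl_ball_powKer_lt_top (by norm_num) one_pos⟩

/-! ### Densities with quartic decay -/

section Density

variable {G : E3 → ℝ} {K : ℝ}

/-- The decay constant is nonnegative. [folklore] -/
theorem decayConst_nonneg (hG : ∀ y, |G y| ≤ K * (1 + ‖y‖) ^ (-4 : ℝ)) : 0 ≤ K := by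
  have h := hG 0
  rw [norm_zero, add_zero, Real.one_rpow, mul_one] at h
  exact (abs_nonneg _).trans h

/-- Quartic decay off the origin: `|G(y)| ≤ K |y|⁻⁴`. [folklore] -/
theorem abs_le_mul_norm_rpow (hG : ∀ y, |G y| ≤ K * (1 + ‖y‖) ^ (-4 : ℝ)) {y : E3} (hy : y ≠ 0) :
    |G y| ≤ K * ‖y‖ ^ (-4 : ℝ) := by
  refine (hG y).trans (mul_le_mul_of_nonneg_left ?_ (decayConst_nonneg hG))
  exact Real.rpow_le_rpow_of_nonpos (norm_pos_iff.2 hy) (by linarith [norm_nonneg y]) (by norm_num)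

/-- Quartic decay off a ball: `|G(y)| ≤ K ρ⁻⁴` for `|y| ≥ ρ > 0`. [folklore] -/
theorem abs_le_of_le_norm (hG : ∀ y, |G y| ≤ K * (1 + ‖y‖) ^ (-4 : ℝ)) {ρ : ℝ} (hρ : 0 < ρ) {y : E3}
    (hy : ρ ≤ ‖y‖) : |G y| ≤ K * ρ ^ (-4 : ℝ) := by
  have hy0 : y ≠ 0 := norm_pos_iff.1 (hρ.trans_le hy)
  refine (abs_le_mul_norm_rpow hG hy0).trans (mul_le_mul_of_nonneg_left ?_ (decayConst_nonneg hG))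
  exact Real.rpow_le_rpow_of_nonpos hρ hy (by norm_num)

/-- A density with quartic decay is bounded by `K`. [folklore] -/
theorem abs_le_decayConst (hG : ∀ y, |G y| ≤ K * (1 + ‖y‖) ^ (-4 : ℝ)) (y : E3) : |G y| ≤ K := by
  refine (hG y).trans ?_
  have h1 : (1 + ‖y‖) ^ (-4 : ℝ) ≤ 1 := by
    apply Real.rpow_le_one_of_one_le_of_nonpos (by linarith [norm_nonneg y]) (by norm_num)
  nlinarith [decayConst_nonneg hG, Real.rpow_nonneg (by positivity : (0:ℝ) ≤ 1 + ‖y‖) (-4 : ℝ)]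

/-- **A density with quartic decay is integrable on `ℝ³`** (Mathlib's `integrable_one_add_norm`,
`4 > 3 = dim`). [folklore] -/
theorem integrable_of_decay (hGm : AEStronglyMeasurable G volume)
    (hG : ∀ y, |G y| ≤ K * (1 + ‖y‖) ^ (-4 : ℝ)) : Integrable G := by
  have h3 : (Module.finrank ℝ E3 : ℝ) < 4 := by rw [finrank_euclideanSpace_fin]; norm_num
  refine Integrable.mono' ((integrable_one_add_norm h3).const_mul K) hGm (ae_of_all _ fun y ↦ ?_)
  rw [Real.norm_eq_abs]
  exact hG y

/-- The first-moment density `y ↦ G(y) y` is integrable on every ball. [folklore] -/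
theorem integrableOn_smul_ball (hGm : AEStronglyMeasurable G volume)
    (hG : ∀ y, |G y| ≤ K * (1 + ‖y‖) ^ (-4 : ℝ)) (ρ : ℝ) :
    IntegrableOn (fun y ↦ G y • y) (ball (0 : E3) ρ) := by
  refine Measure.integrableOn_of_bounded measure_ball_lt_top.ne (hGm.smul aestronglyMeasurable_id)
    (M := K * |ρ|) ((ae_restrict_mem measurableSet_ball).mono fun y hy ↦ ?_)
  rw [mem_ball_zero_iff] at hy
  rw [norm_smul, Real.norm_eq_abs]
  exact mul_le_mul (abs_le_decayConst hG y) (hy.le.trans (le_abs_self ρ)) (norm_nonneg _)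
    (decayConst_nonneg hG)

/-- The weighted density `y ↦ G(y) ⟨x, y⟩` is integrable on every ball. [folklore] -/
theorem integrableOn_mul_inner_ball (hGm : AEStronglyMeasurable G volume)
    (hG : ∀ y, |G y| ≤ K * (1 + ‖y‖) ^ (-4 : ℝ)) (x : E3) (ρ : ℝ) :
    IntegrableOn (fun y ↦ G y * ⟪x, y⟫_ℝ) (ball (0 : E3) ρ) := by
  have h := (integrableOn_smul_ball hGm hG ρ).integrable
  have h2 : Integrable (fun y ↦ ⟪x, G y • y⟫_ℝ) (volume.restrict (ball (0 : E3) ρ)) := h.const_inner x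
  refine h2.congr (ae_of_all _ fun y ↦ ?_)
  simp only [real_inner_smul_right]

/-- **The potential integrand is integrable**: for every `x`, `y ↦ G(y)/|x - y|` is integrable on
`ℝ³` (near `x`: `|x - y|⁻¹` is integrable on balls of `ℝ³` and `G` is bounded; far from `x`: the
kernel is bounded and `G ∈ L¹`). [folklore] -/
theorem integrable_inv_norm_sub_mul (hGm : AEStronglyMeasurable G volume)
    (hG : ∀ y, |G y| ≤ K * (1 + ‖y‖) ^ (-4 : ℝ)) (x : E3) :
    Integrable fun y ↦ ‖x - y‖⁻¹ * G y := by
  have hK := decayConst_nonneg hG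
  have hmeas : AEStronglyMeasurable (fun y : E3 ↦ ‖x - y‖⁻¹ * G y) volume :=
    ((measurable_id.const_sub x).norm.inv.aestronglyMeasurable).mul hGm
  rw [← integrableOn_univ, ← union_compl_self (ball x 1)]
  refine IntegrableOn.union ?_ ?_
  · -- near `x`: translate to a ball centred at the origin
    set e : E3 → E3 := fun z ↦ z + x with he
    have hpre : e ⁻¹' (ball x 1) = ball 0 1 := by
      ext z; simp [he, dist_eq_norm]
    have hemb : MeasurableEmbedding e := (MeasurableEquiv.addRight x).measurableEmbedding
    have hmp : MeasurePreserving e volume volume := measurePreserving_add_right volume x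
    rw [← hmp.integrableOn_comp_preimage hemb, hpre]
    refine integrableOn_ball_of_norm_le_rpow (by rw [finrank_euclideanSpace_fin]; norm_num) (C := K)
      (α := 1) (by rw [finrank_euclideanSpace_fin]; norm_num) (ae_of_all _ fun z ↦ ?_)
      (hmeas.comp_measurePreserving hmp)
    have hxz : ‖x - (z + x)‖ = ‖z‖ := by
      rw [show x - (z + x) = -z by abel, norm_neg]
    simp only [Function.comp_apply, he, norm_mul, norm_inv, Real.norm_eq_abs, Real.rpow_neg_one, hxz,
      abs_norm]
    rw [mul_comm]
    exact mul_le_mul_of_nonneg_right (abs_le_decayConst hG _) (inv_nonneg.2 (norm_nonneg _))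
  · -- far from `x`: bounded kernel against an integrable density
    refine Integrable.bdd_mul (integrable_of_decay hGm hG).integrableOn ?_ (c := 1)
      ((ae_restrict_mem measurableSet_ball.compl).mono fun y hy ↦ ?_)
    · refine ContinuousOn.aestronglyMeasurable (fun y hy ↦ ?_) measurableSet_ball.compl
      have hxy : x - y ≠ 0 := by
        intro h
        rw [sub_eq_zero] at h
        rw [h, mem_compl_iff] at hy
        exact hy (mem_ball_self one_pos)
      exact (((continuous_const.sub continuous_id).norm).continuousAt.inv₀
        (norm_ne_zero_iff.2 hxy)).continuousWithinAt
    · rw [mem_compl_iff, mem_ball, dist_eq_norm, not_lt, norm_sub_rev] at hy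
      rw [norm_inv, norm_norm]
      exact inv_le_one_of_one_le₀ hy

end Density

/-! ### The radial constants -/

/-! The three radial constants `c₁ = ∫_{|u| < 1} |u|⁻¹ du` (`= 2π`), `c₂ = ∫_{|u| < 1} |u|⁻² du`
(`= 4π`), `c₄ = ∫_{|u| ≥ 1} |u|⁻⁴ du` (`= 4π`) are written out as `(∫⁻ …).toReal`; only their
finiteness is used (nonnegativity is `ENNReal.toReal_nonneg`). -/

/-- `∫_{|z| < ρ} |z|⁻¹ dz = c₁ ρ²`. [folklore] -/
theorem setLIntegral_ball_powKer_one {ρ : ℝ} (hρ : 0 < ρ) :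
    ∫⁻ z in ball (0 : E3) ρ, powKer 1 z = ENNReal.ofReal (ρ ^ 2 * (∫⁻ u in ball (0 : E3) 1, powKer 1 u).toReal) := by
  rw [setLIntegral_ball_powKer_eq 1 hρ,
    ENNReal.ofReal_mul (by positivity), ENNReal.ofReal_toReal radialConst_lt_top.1.ne,
    show (3 : ℝ) - 1 = 2 by norm_num, Real.rpow_two]

/-- `∫_{|z| < ρ} |z|⁻² dz = c₂ ρ`. [folklore] -/
theorem setLIntegral_ball_powKer_two {ρ : ℝ} (hρ : 0 < ρ) :
    ∫⁻ z in ball (0 : E3) ρ, powKer 2 z = ENNReal.ofReal (ρ * (∫⁻ u in ball (0 : E3) 1, powKer 2 u).toReal) := by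
  rw [setLIntegral_ball_powKer_eq 2 hρ,
    ENNReal.ofReal_mul hρ.le, ENNReal.ofReal_toReal radialConst_lt_top.2.1.ne,
    show (3 : ℝ) - 2 = 1 by norm_num, Real.rpow_one]

/-- `∫_{|z| ≥ ρ} |z|⁻⁴ dz = c₄ / ρ`. [folklore] -/
theorem setLIntegral_compl_ball_powKer_four {ρ : ℝ} (hρ : 0 < ρ) :
    ∫⁻ z in (ball (0 : E3) ρ)ᶜ, powKer 4 z =
      ENNReal.ofReal (ρ⁻¹ * (∫⁻ u in (ball (0 : E3) 1)ᶜ, powKer 4 u).toReal) := by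
  rw [setLIntegral_compl_ball_powKer_eq 4 hρ,
    ENNReal.ofReal_mul (inv_nonneg.2 hρ.le), ENNReal.ofReal_toReal radialConst_lt_top.2.2.ne,
    show (3 : ℝ) - 4 = -1 by norm_num, Real.rpow_neg_one]

/-! ### The far region `|y| ≥ |x|/2` -/

section FarField

variable {G : E3 → ℝ} {K : ℝ}

/-- **The far region.** For `|x| = r > 0` and a density with `|G| ≤ K(1 + |y|)⁻⁴`,
`|∫_{|y| ≥ r/2} (1/|x - y| - 1/|x|) G(y) dy| ≤ K (4c₁ + 6c₄) r⁻²`: on `|x - y| < r/2` (where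
`|y| ≥ r/2`, so `|G| ≤ 16K r⁻⁴`) the kernel `1/|x - y|` integrates to `c₁ (r/2)²`, and elsewhere
the kernel difference is at most `3/r` against `∫_{|y| ≥ r/2} K|y|⁻⁴ = 2Kc₄/r`. [folklore] -/
theorem norm_integral_far_le (hG : ∀ y, |G y| ≤ K * (1 + ‖y‖) ^ (-4 : ℝ)) {x : E3} (hx : x ≠ 0) :
    ‖∫ y in (ball (0 : E3) (‖x‖ / 2))ᶜ, (‖x - y‖⁻¹ - ‖x‖⁻¹) * G y‖ ≤
      K * (4 * (∫⁻ u in ball (0 : E3) 1, powKer 1 u).toReal +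
        6 * (∫⁻ u in (ball (0 : E3) 1)ᶜ, powKer 4 u).toReal) / ‖x‖ ^ 2 := by
  have hK := decayConst_nonneg hG
  set c₁ : ℝ := (∫⁻ u in ball (0 : E3) 1, powKer 1 u).toReal with hc₁
  set c₄ : ℝ := (∫⁻ u in (ball (0 : E3) 1)ᶜ, powKer 4 u).toReal with hc₄
  set r := ‖x‖ with hr_def
  have hr : 0 < r := norm_pos_iff.2 hx
  have hr2 : 0 < r / 2 := half_pos hr
  set a : ℝ := 16 * K / r ^ 4 with ha
  set b : ℝ := 3 * K / r with hb
  have ha0 : 0 ≤ a := by positivity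
  have hb0 : 0 ≤ b := by positivity
  -- the dominating function
  set Φ : E3 → ℝ≥0∞ := fun y ↦ ENNReal.ofReal a * (ball x (r / 2)).indicator (fun y ↦ powKer 1 (y - x)) y
    + ENNReal.ofReal b * powKer 4 y with hΦ
  have hind_meas : Measurable fun y ↦ (ball x (r / 2)).indicator (fun y ↦ powKer 1 (y - x)) y :=
    (measurable_powKer_sub 1 x).indicator measurableSet_ball
  -- pointwise bound on the far region
  have hpt : ∀ y ∈ (ball (0 : E3) (r / 2))ᶜ,
      ENNReal.ofReal ‖(‖x - y‖⁻¹ - r⁻¹) * G y‖ ≤ Φ y := by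
    intro y hy
    rw [mem_compl_iff, mem_ball_zero_iff, not_lt] at hy
    have hy0 : y ≠ 0 := norm_pos_iff.1 (hr2.trans_le hy)
    have hGy : |G y| ≤ K * ‖y‖ ^ (-4 : ℝ) := abs_le_mul_norm_rpow hG hy0
    have hpow0 : 0 ≤ ‖y‖ ^ (-4 : ℝ) := Real.rpow_nonneg (norm_nonneg _) _
    have hker : |‖x - y‖⁻¹ - r⁻¹| ≤ ‖x - y‖⁻¹ + r⁻¹ := by
      refine (abs_sub _ _).trans ?_
      rw [abs_of_nonneg (inv_nonneg.2 (norm_nonneg _)), abs_of_pos (inv_pos.2 hr)]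
    rw [Real.norm_eq_abs, abs_mul]
    by_cases hyx : y ∈ ball x (r / 2)
    · -- near `x`
      rw [hΦ]
      simp only [indicator_of_mem hyx]
      rw [powKer_apply, powKer_apply, ← ENNReal.ofReal_mul ha0, ← ENNReal.ofReal_mul hb0,
        ← ENNReal.ofReal_add (by positivity) (by positivity)]
      refine ENNReal.ofReal_le_ofReal ?_
      have hyx' : ‖x - y‖ < r / 2 := by rwa [mem_ball, dist_eq_norm, norm_sub_rev] at hyx
      have hGy' : |G y| ≤ K * (r / 2) ^ (-4 : ℝ) := abs_le_of_le_norm hG hr2 hy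
      have h16 : (r / 2) ^ (-4 : ℝ) = 16 / r ^ 4 := by
        rw [Real.rpow_neg hr2.le, show (4 : ℝ) = (4 : ℕ) by norm_num, Real.rpow_natCast]
        field_simp
        ring
      rw [h16] at hGy'
      rw [norm_sub_rev y x, Real.rpow_neg_one]
      calc |‖x - y‖⁻¹ - r⁻¹| * |G y| ≤ (‖x - y‖⁻¹ + r⁻¹) * |G y| := by gcongr
        _ = ‖x - y‖⁻¹ * |G y| + r⁻¹ * |G y| := by ring
        _ ≤ ‖x - y‖⁻¹ * (K * (16 / r ^ 4)) + r⁻¹ * (K * ‖y‖ ^ (-4 : ℝ)) := by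
            gcongr
        _ = a * ‖x - y‖⁻¹ + (K / r) * ‖y‖ ^ (-4 : ℝ) := by rw [ha]; ring
        _ ≤ a * ‖x - y‖⁻¹ + b * ‖y‖ ^ (-4 : ℝ) := by
            gcongr
            rw [hb, div_le_div_iff_of_pos_right hr]
            linarith
    · -- away from `x`
      rw [hΦ]
      simp only [indicator_of_notMem hyx, mul_zero, zero_add]
      rw [powKer_apply, ← ENNReal.ofReal_mul hb0]
      refine ENNReal.ofReal_le_ofReal ?_
      have hyx' : r / 2 ≤ ‖x - y‖ := by
        rw [mem_ball, dist_eq_norm, norm_sub_rev, not_lt] at hyx; exact hyx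
      have hxy0 : 0 < ‖x - y‖ := hr2.trans_le hyx'
      have hinv : ‖x - y‖⁻¹ ≤ 2 / r := by
        rw [inv_le_comm₀ hxy0 (by positivity)]
        rw [inv_div]; exact hyx'
      calc |‖x - y‖⁻¹ - r⁻¹| * |G y| ≤ (‖x - y‖⁻¹ + r⁻¹) * |G y| := by gcongr
        _ ≤ (2 / r + r⁻¹) * (K * ‖y‖ ^ (-4 : ℝ)) := by gcongr
        _ = b * ‖y‖ ^ (-4 : ℝ) := by rw [hb]; ring
  -- integrate the bound
  have hint_le : ∫⁻ y in (ball (0 : E3) (r / 2))ᶜ, ENNReal.ofReal ‖(‖x - y‖⁻¹ - r⁻¹) * G y‖ ≤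
      ENNReal.ofReal (K * (4 * c₁ + 6 * c₄) / r ^ 2) := by
    calc ∫⁻ y in (ball (0 : E3) (r / 2))ᶜ, ENNReal.ofReal ‖(‖x - y‖⁻¹ - r⁻¹) * G y‖
        ≤ ∫⁻ y in (ball (0 : E3) (r / 2))ᶜ, Φ y := setLIntegral_mono' measurableSet_ball.compl hpt
      _ = ENNReal.ofReal a * (∫⁻ y in (ball (0 : E3) (r / 2))ᶜ,
              (ball x (r / 2)).indicator (fun y ↦ powKer 1 (y - x)) y)
            + ENNReal.ofReal b * (∫⁻ y in (ball (0 : E3) (r / 2))ᶜ, powKer 4 y) := by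
          rw [hΦ, lintegral_add_left (hind_meas.const_mul _), lintegral_const_mul _ hind_meas,
            lintegral_const_mul _ (measurable_powKer 4)]
      _ ≤ ENNReal.ofReal a * (∫⁻ y, (ball x (r / 2)).indicator (fun y ↦ powKer 1 (y - x)) y)
            + ENNReal.ofReal b * (∫⁻ y in (ball (0 : E3) (r / 2))ᶜ, powKer 4 y) := by
          gcongr
          exact Measure.restrict_le_self
      _ = ENNReal.ofReal a * ENNReal.ofReal ((r / 2) ^ 2 * c₁)
            + ENNReal.ofReal b * ENNReal.ofReal ((r / 2)⁻¹ * c₄) := by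
          rw [lintegral_indicator measurableSet_ball, setLIntegral_ball_comp_sub (powKer 1) x (r / 2),
            setLIntegral_ball_powKer_one hr2, setLIntegral_compl_ball_powKer_four hr2]
      _ = ENNReal.ofReal (K * (4 * c₁ + 6 * c₄) / r ^ 2) := by
          rw [← ENNReal.ofReal_mul ha0, ← ENNReal.ofReal_mul hb0,
            ← ENNReal.ofReal_add (mul_nonneg ha0 (mul_nonneg (sq_nonneg _) ENNReal.toReal_nonneg))
              (mul_nonneg hb0 (mul_nonneg (inv_nonneg.2 hr2.le) ENNReal.toReal_nonneg))]
          congr 1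
          rw [ha, hb]
          field_simp
          ring
  calc ‖∫ y in (ball (0 : E3) (r / 2))ᶜ, (‖x - y‖⁻¹ - r⁻¹) * G y‖
      ≤ (∫⁻ y in (ball (0 : E3) (r / 2))ᶜ, ENNReal.ofReal ‖(‖x - y‖⁻¹ - r⁻¹) * G y‖).toReal :=
        norm_integral_le_lintegral_norm _
    _ ≤ (ENNReal.ofReal (K * (4 * c₁ + 6 * c₄) / r ^ 2)).toReal :=
        ENNReal.toReal_mono ENNReal.ofReal_ne_top hint_le
    _ = K * (4 * c₁ + 6 * c₄) / r ^ 2 := by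
        have : 0 ≤ c₁ := ENNReal.toReal_nonneg
        have : 0 ≤ c₄ := ENNReal.toReal_nonneg
        exact ENNReal.toReal_ofReal (by positivity)

/-! ### The near region `|y| < |x|/2`: the dipole term -/

/-- The kernel difference `y ↦ (1/|x - y| - 1/|x|) G(y)` is integrable. [folklore] -/
theorem integrable_kernelDiff_mul (hGm : AEStronglyMeasurable G volume)
    (hG : ∀ y, |G y| ≤ K * (1 + ‖y‖) ^ (-4 : ℝ)) (x : E3) :
    Integrable fun y ↦ (‖x - y‖⁻¹ - ‖x‖⁻¹) * G y := by
  refine ((integrable_inv_norm_sub_mul hGm hG x).sub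
    ((integrable_of_decay hGm hG).const_mul ‖x‖⁻¹)).congr (ae_of_all _ fun y ↦ ?_)
  simp only [Pi.sub_apply]
  ring

/-- **The near region.** For `x ≠ 0`, `|x| = r`, a density with `|G| ≤ K(1 + |y|)⁻⁴` and
truncated first moment `|∫_{|y| < r/2} G(y) y dy| ≤ K'`:
`|∫_{|y| < r/2} (1/|x - y| - 1/|x|) G(y) dy| ≤ (K' + 3Kc₂) r⁻²`. The kernel difference is the
dipole term `⟨x, y⟩/r³`, which integrates against `G` to `⟨x, ∫ G y⟩/r³`, of size `≤ K'/r²`, plus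
a remainder `≤ 6|y|²/r³` (`abs_inv_norm_sub_sub_inv_norm_sub_inner_le`), which integrates against
`|G| ≤ K|y|⁻⁴` to at most `6K r⁻³ ∫_{|y| < r/2} |y|⁻² = 3Kc₂/r²`. [folklore] -/
theorem norm_integral_near_le (hGm : AEStronglyMeasurable G volume)
    (hG : ∀ y, |G y| ≤ K * (1 + ‖y‖) ^ (-4 : ℝ)) {x : E3} (hx : x ≠ 0) {K' : ℝ}
    (hmom : ‖∫ y in ball (0 : E3) (‖x‖ / 2), G y • y‖ ≤ K') :
    ‖∫ y in ball (0 : E3) (‖x‖ / 2), (‖x - y‖⁻¹ - ‖x‖⁻¹) * G y‖ ≤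
      (K' + 3 * K * (∫⁻ u in ball (0 : E3) 1, powKer 2 u).toReal) / ‖x‖ ^ 2 := by
  have hK := decayConst_nonneg hG
  set c₂ : ℝ := (∫⁻ u in ball (0 : E3) 1, powKer 2 u).toReal with hc₂
  set r := ‖x‖ with hr_def
  have hr : 0 < r := norm_pos_iff.2 hx
  have hr2 : 0 < r / 2 := half_pos hr
  set B : Set E3 := ball (0 : E3) (r / 2) with hB
  -- the two integrable pieces
  have hkG : IntegrableOn (fun y ↦ (‖x - y‖⁻¹ - r⁻¹) * G y) B :=
    (integrable_kernelDiff_mul hGm hG x).integrableOn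
  have hlin : IntegrableOn (fun y ↦ (r ^ 3)⁻¹ * (G y * ⟪x, y⟫_ℝ)) B :=
    (integrableOn_mul_inner_ball hGm hG x (r / 2)).const_mul _
  -- the dipole term
  have hdip : ∫ y in B, (r ^ 3)⁻¹ * (G y * ⟪x, y⟫_ℝ) = (r ^ 3)⁻¹ * ⟪x, ∫ y in B, G y • y⟫_ℝ := by
    rw [integral_const_mul, ← integral_inner (integrableOn_smul_ball hGm hG (r / 2)) x]
    congr 1
    refine integral_congr_ae (ae_of_all _ fun y ↦ ?_)
    simp only [real_inner_smul_right]
  have hdip_le : ‖∫ y in B, (r ^ 3)⁻¹ * (G y * ⟪x, y⟫_ℝ)‖ ≤ K' / r ^ 2 := by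
    rw [hdip, norm_mul, norm_inv, norm_pow, Real.norm_of_nonneg hr.le]
    have h1 : ‖⟪x, ∫ y in B, G y • y⟫_ℝ‖ ≤ r * K' :=
      (norm_inner_le_norm _ _).trans (mul_le_mul_of_nonneg_left hmom (norm_nonneg _))
    calc (r ^ 3)⁻¹ * ‖⟪x, ∫ y in B, G y • y⟫_ℝ‖ ≤ (r ^ 3)⁻¹ * (r * K') := by gcongr
      _ = K' / r ^ 2 := by field_simp
  -- the remainder term, pointwise
  have hpt : ∀ y ∈ B, ENNReal.ofReal ‖(‖x - y‖⁻¹ - r⁻¹) * G y - (r ^ 3)⁻¹ * (G y * ⟪x, y⟫_ℝ)‖ ≤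
      ENNReal.ofReal (6 * K / r ^ 3) * powKer 2 y := by
    intro y hy
    rw [hB, mem_ball_zero_iff] at hy
    by_cases hy0 : y = 0
    · subst hy0
      have h0 : (‖x - 0‖⁻¹ - r⁻¹) * G 0 - (r ^ 3)⁻¹ * (G 0 * ⟪x, (0 : E3)⟫_ℝ) = 0 := by
        rw [sub_zero, ← hr_def, inner_zero_right]; ring
      rw [h0, norm_zero, ENNReal.ofReal_zero]
      exact zero_le
    have hfac : (‖x - y‖⁻¹ - r⁻¹) * G y - (r ^ 3)⁻¹ * (G y * ⟪x, y⟫_ℝ) =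
        (‖x - y‖⁻¹ - r⁻¹ - ⟪x, y⟫_ℝ / r ^ 3) * G y := by ring
    rw [hfac, powKer_apply, ← ENNReal.ofReal_mul (by positivity)]
    refine ENNReal.ofReal_le_ofReal ?_
    rw [norm_mul, Real.norm_eq_abs, Real.norm_eq_abs]
    have hT := abs_inv_norm_sub_sub_inv_norm_sub_inner_le hx hy.le
    have hGy : |G y| ≤ K * ‖y‖ ^ (-4 : ℝ) := abs_le_mul_norm_rpow hG hy0
    have hyn : 0 < ‖y‖ := norm_pos_iff.2 hy0
    have hpow : ‖y‖ ^ 2 * ‖y‖ ^ (-4 : ℝ) = ‖y‖ ^ (-2 : ℝ) := by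
      rw [Real.rpow_neg hyn.le, Real.rpow_neg hyn.le, show (4 : ℝ) = (4 : ℕ) by norm_num,
        show (2 : ℝ) = (2 : ℕ) by norm_num, Real.rpow_natCast, Real.rpow_natCast]
      field_simp
    calc |‖x - y‖⁻¹ - r⁻¹ - ⟪x, y⟫_ℝ / r ^ 3| * |G y|
        ≤ (6 * ‖y‖ ^ 2 / r ^ 3) * (K * ‖y‖ ^ (-4 : ℝ)) := by gcongr
      _ = 6 * K / r ^ 3 * (‖y‖ ^ 2 * ‖y‖ ^ (-4 : ℝ)) := by ring
      _ = 6 * K / r ^ 3 * ‖y‖ ^ (-2 : ℝ) := by rw [hpow]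
  have hrem_le : ‖∫ y in B, ((‖x - y‖⁻¹ - r⁻¹) * G y - (r ^ 3)⁻¹ * (G y * ⟪x, y⟫_ℝ))‖ ≤
      3 * K * c₂ / r ^ 2 := by
    have hlint : ∫⁻ y in B, ENNReal.ofReal ‖(‖x - y‖⁻¹ - r⁻¹) * G y - (r ^ 3)⁻¹ * (G y * ⟪x, y⟫_ℝ)‖
        ≤ ENNReal.ofReal (3 * K * c₂ / r ^ 2) := by
      calc ∫⁻ y in B, ENNReal.ofReal ‖(‖x - y‖⁻¹ - r⁻¹) * G y - (r ^ 3)⁻¹ * (G y * ⟪x, y⟫_ℝ)‖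
          ≤ ∫⁻ y in B, ENNReal.ofReal (6 * K / r ^ 3) * powKer 2 y :=
            setLIntegral_mono' measurableSet_ball hpt
        _ = ENNReal.ofReal (6 * K / r ^ 3) * ENNReal.ofReal (r / 2 * c₂) := by
            rw [lintegral_const_mul _ (measurable_powKer 2), hB, setLIntegral_ball_powKer_two hr2]
        _ = ENNReal.ofReal (3 * K * c₂ / r ^ 2) := by
            rw [← ENNReal.ofReal_mul (by positivity)]
            congr 1
            field_simp
            ring
    calc ‖∫ y in B, ((‖x - y‖⁻¹ - r⁻¹) * G y - (r ^ 3)⁻¹ * (G y * ⟪x, y⟫_ℝ))‖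
        ≤ (∫⁻ y in B, ENNReal.ofReal
            ‖(‖x - y‖⁻¹ - r⁻¹) * G y - (r ^ 3)⁻¹ * (G y * ⟪x, y⟫_ℝ)‖).toReal :=
          norm_integral_le_lintegral_norm _
      _ ≤ (ENNReal.ofReal (3 * K * c₂ / r ^ 2)).toReal :=
          ENNReal.toReal_mono ENNReal.ofReal_ne_top hlint
      _ = 3 * K * c₂ / r ^ 2 :=
          ENNReal.toReal_ofReal (by have : 0 ≤ c₂ := ENNReal.toReal_nonneg; positivity)
  -- assemble
  have hsplit : ∫ y in B, (‖x - y‖⁻¹ - r⁻¹) * G y =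
      (∫ y in B, ((‖x - y‖⁻¹ - r⁻¹) * G y - (r ^ 3)⁻¹ * (G y * ⟪x, y⟫_ℝ))) +
        ∫ y in B, (r ^ 3)⁻¹ * (G y * ⟪x, y⟫_ℝ) := by
    rw [integral_sub hkG hlin, sub_add_cancel]
  rw [hsplit]
  refine (norm_add_le _ _).trans ?_
  calc ‖∫ y in B, ((‖x - y‖⁻¹ - r⁻¹) * G y - (r ^ 3)⁻¹ * (G y * ⟪x, y⟫_ℝ))‖ +
        ‖∫ y in B, (r ^ 3)⁻¹ * (G y * ⟪x, y⟫_ℝ)‖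
      ≤ 3 * K * c₂ / r ^ 2 + K' / r ^ 2 := add_le_add hrem_le hdip_le
    _ = (K' + 3 * K * c₂) / r ^ 2 := by ring

/-! ### The far-field expansion -/

/-- **Far-field (monopole) expansion of the Newtonian potential of a density with quartic decay
and bounded truncated first moments.** Let `G : ℝ³ → ℝ` be measurable with
`|G(y)| ≤ K (1 + |y|)⁻⁴` and `|∫_{|y| < ρ} G(y) y dy| ≤ K'` for all `ρ ≥ 1`. Then, as `|x| → ∞`,

  `∫ G(y)/|x - y| dy = (∫ G)/|x| + O(|x|⁻²)`,

with the explicit constant `K' + K(4c₁ + 3c₂ + 6c₄)` for `|x| ≥ 2`. This is the potential-theoretic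
estimate behind Schoen–Yau's expansion `v = A/r + ω`, `|ω| ≤ k₁₁/(1 + r²)`, of solutions of
`Δv - fv = h` with `|f| + |h| = O(r⁻⁴)` (Comm. Math. Phys. 65 (1979), Lemma 3.2, (3.12)–(3.18):
"the following inequalities are easily checked"), here for the flat kernel and a general density.
The moment hypothesis cannot be dropped: for `G = O(|y|⁻⁴)` alone the dipole term
`⟨x, ∫_{|y| < |x|/2} G y⟩/|x|³` may be of size `|x|⁻² log |x|` (e.g. `G(y) = y₁ |y|⁻⁵`); it is
automatic when `G = O(|y|^{-q})` with `q > 4` (`integral_inv_norm_sub_mul_sub_isBigO_of_decay`).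
[cite: SchoenYauPMT1979, Lemma 3.2, (3.12)–(3.18)] -/
theorem integral_inv_norm_sub_mul_sub_isBigO (hGm : AEStronglyMeasurable G volume)
    (hG : ∀ y, |G y| ≤ K * (1 + ‖y‖) ^ (-4 : ℝ)) {K' : ℝ}
    (hmom : ∀ ρ : ℝ, 1 ≤ ρ → ‖∫ y in ball (0 : E3) ρ, G y • y‖ ≤ K') :
    (fun x : E3 ↦ (∫ y, ‖x - y‖⁻¹ * G y) - (∫ y, G y) * ‖x‖⁻¹) =O[cobounded E3]
      fun x ↦ ‖x‖ ^ (-2 : ℝ) := by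
  have hK := decayConst_nonneg hG
  set c₁ : ℝ := (∫⁻ u in ball (0 : E3) 1, powKer 1 u).toReal with hc₁
  set c₂ : ℝ := (∫⁻ u in ball (0 : E3) 1, powKer 2 u).toReal with hc₂
  set c₄ : ℝ := (∫⁻ u in (ball (0 : E3) 1)ᶜ, powKer 4 u).toReal with hc₄
  refine IsBigO.of_bound (K' + 3 * K * c₂ + K * (4 * c₁ + 6 * c₄)) ?_
  filter_upwards [eventually_cobounded_le_norm (E := E3) 2] with x hx
  have hr : 0 < ‖x‖ := by linarith
  have hx0 : x ≠ 0 := norm_pos_iff.1 hr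
  -- the error as one integral of the kernel difference
  have hE : (∫ y, ‖x - y‖⁻¹ * G y) - (∫ y, G y) * ‖x‖⁻¹ = ∫ y, (‖x - y‖⁻¹ - ‖x‖⁻¹) * G y := by
    rw [← integral_mul_const, ← integral_sub (integrable_inv_norm_sub_mul hGm hG x)
      ((integrable_of_decay hGm hG).mul_const _)]
    refine integral_congr_ae (ae_of_all _ fun y ↦ ?_)
    ring
  rw [hE, ← integral_add_compl (measurableSet_ball (x := (0 : E3)) (ε := ‖x‖ / 2))
    (integrable_kernelDiff_mul hGm hG x)]
  have hnear := norm_integral_near_le hGm hG hx0 (hmom (‖x‖ / 2) (by linarith))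
  have hfar := norm_integral_far_le hG hx0
  rw [Real.norm_of_nonneg (Real.rpow_nonneg (norm_nonneg _) _), Real.rpow_neg (norm_nonneg _),
    Real.rpow_two]
  refine (norm_add_le _ _).trans ?_
  calc ‖∫ y in ball (0 : E3) (‖x‖ / 2), (‖x - y‖⁻¹ - ‖x‖⁻¹) * G y‖ +
        ‖∫ y in (ball (0 : E3) (‖x‖ / 2))ᶜ, (‖x - y‖⁻¹ - ‖x‖⁻¹) * G y‖
      ≤ (K' + 3 * K * c₂) / ‖x‖ ^ 2 + K * (4 * c₁ + 6 * c₄) / ‖x‖ ^ 2 :=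
        add_le_add hnear hfar
    _ = (K' + 3 * K * c₂ + K * (4 * c₁ + 6 * c₄)) * (‖x‖ ^ 2)⁻¹ := by ring

/-- **Far-field expansion for densities with better than quartic decay**: if
`|G(y)| ≤ K (1 + |y|)^{-q}` with `q > 4` then `∫ G(y)/|x - y| dy = (∫ G)/|x| + O(|x|⁻²)` — the
first moment `∫ |G| |y| ≤ K ∫ (1 + |y|)^{1-q} < ∞` converges absolutely, so the moment hypothesis
of `integral_inv_norm_sub_mul_sub_isBigO` holds. [folklore] -/
theorem integral_inv_norm_sub_mul_sub_isBigO_of_decay (hGm : AEStronglyMeasurable G volume)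
    {q : ℝ} (hq : 4 < q) (hG : ∀ y, |G y| ≤ K * (1 + ‖y‖) ^ (-q)) :
    (fun x : E3 ↦ (∫ y, ‖x - y‖⁻¹ * G y) - (∫ y, G y) * ‖x‖⁻¹) =O[cobounded E3]
      fun x ↦ ‖x‖ ^ (-2 : ℝ) := by
  -- `K ≥ 0`
  have hK : 0 ≤ K := by
    have h := hG 0
    rw [norm_zero, add_zero, Real.one_rpow, mul_one] at h
    exact (abs_nonneg _).trans h
  -- quartic decay
  have hG4 : ∀ y, |G y| ≤ K * (1 + ‖y‖) ^ (-4 : ℝ) := fun y ↦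
    (hG y).trans (mul_le_mul_of_nonneg_left
      (Real.rpow_le_rpow_of_exponent_le (by linarith [norm_nonneg y]) (by linarith)) hK)
  -- the absolute first moment
  have h3 : (Module.finrank ℝ E3 : ℝ) < q - 1 := by rw [finrank_euclideanSpace_fin]; push_cast; linarith
  have hdom : Integrable (fun y : E3 ↦ K * (1 + ‖y‖) ^ (-(q - 1)))  :=
    (integrable_one_add_norm h3).const_mul K
  have hbound : ∀ y : E3, ‖G y • y‖ ≤ K * (1 + ‖y‖) ^ (-(q - 1)) := by
    intro y
    have h1 : 0 < 1 + ‖y‖ := by linarith [norm_nonneg y]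
    rw [norm_smul, Real.norm_eq_abs]
    calc |G y| * ‖y‖ ≤ K * (1 + ‖y‖) ^ (-q) * (1 + ‖y‖) :=
          mul_le_mul (hG y) (by linarith) (norm_nonneg _) (mul_nonneg hK (Real.rpow_nonneg h1.le _))
      _ = K * (1 + ‖y‖) ^ (-(q - 1)) := by
          rw [neg_sub, Real.rpow_sub h1, Real.rpow_one, Real.rpow_neg h1.le]
          field_simp
  have hint : Integrable fun y : E3 ↦ G y • y :=
    hdom.mono' (hGm.smul aestronglyMeasurable_id) (ae_of_all _ hbound)
  refine integral_inv_norm_sub_mul_sub_isBigO hGm hG4 (K' := ∫ y : E3, K * (1 + ‖y‖) ^ (-(q - 1)))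
    fun ρ _ ↦ ?_
  calc ‖∫ y in ball (0 : E3) ρ, G y • y‖ ≤ ∫ y in ball (0 : E3) ρ, ‖G y • y‖ :=
        norm_integral_le_integral_norm _
    _ ≤ ∫ y, ‖G y • y‖ := setIntegral_le_integral hint.norm (ae_of_all _ fun y ↦ norm_nonneg _)
    _ ≤ ∫ y, K * (1 + ‖y‖) ^ (-(q - 1)) := integral_mono hint.norm hdom hbound

/-- **Far field of the Newtonian potential `Γ ⋆ G`, `Γ(z) = -(4π|z|)⁻¹`**, in the form of
`Literature.Geometry.Lorentzian.newtonPotential_sub_isBigO` (there for compactly supported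
continuous densities): under quartic decay and bounded truncated first moments,
`∫ Γ(x - y) G(y) dy = -(4π)⁻¹ (∫ G) |x|⁻¹ + O(|x|⁻²)`. [folklore] -/
theorem integral_newtonKernel_mul_sub_isBigO (hGm : AEStronglyMeasurable G volume)
    (hG : ∀ y, |G y| ≤ K * (1 + ‖y‖) ^ (-4 : ℝ)) {K' : ℝ}
    (hmom : ∀ ρ : ℝ, 1 ≤ ρ → ‖∫ y in ball (0 : E3) ρ, G y • y‖ ≤ K') :
    (fun x : E3 ↦ (∫ y, newtonKernel (x - y) * G y) - (-(4 * π)⁻¹ * ∫ y, G y) * ‖x‖⁻¹)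
      =O[cobounded E3] fun x ↦ ‖x‖ ^ (-2 : ℝ) := by
  have h := (integral_inv_norm_sub_mul_sub_isBigO hGm hG hmom).const_mul_left (-(4 * π)⁻¹)
  refine h.congr' (Eventually.of_forall fun x ↦ ?_) EventuallyEq.rfl
  have hker : ∀ y : E3, newtonKernel (x - y) * G y = -(4 * π)⁻¹ * (‖x - y‖⁻¹ * G y) := by
    intro y
    rw [newtonKernel_eq, mul_inv]
    ring
  simp_rw [hker, integral_const_mul]
  ring

/-! ### Moments through smooth radial cutoffs -/

/-- **Sharp truncated moments from smoothly truncated ones.** For a density with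
`|G| ≤ K(1 + |y|)⁻⁴` and the radial cutoff `θ_ρ = radialCutoff ρ (2ρ)` (`= 1` on `|y| ≤ ρ`, `= 0`
on `|y| ≥ 2ρ`, values in `[0, 1]`), the moments over balls and the smoothly cut-off moments differ
by at most `∫_{ρ ≤ |y| < 2ρ} |G| |y| ≤ 2ρK ∫_{|y| ≥ ρ} |y|⁻⁴ = 2Kc₄`, uniformly in `ρ > 0`:
`|∫_{|y| < ρ} G(y) y dy| ≤ |∫ θ_ρ(y) G(y) y dy| + 2Kc₄`. (Smooth truncations are the convenient
ones when the moment bound is obtained by integration by parts.) [folklore] -/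
theorem norm_setIntegral_smul_le_of_radialCutoff (hGm : AEStronglyMeasurable G volume)
    (hG : ∀ y, |G y| ≤ K * (1 + ‖y‖) ^ (-4 : ℝ)) {ρ : ℝ} (hρ : 0 < ρ) :
    ‖∫ y in ball (0 : E3) ρ, G y • y‖ ≤
      ‖∫ y, (radialCutoff ρ (2 * ρ) y * G y) • y‖ + 2 * K * (∫⁻ u in (ball (0 : E3) 1)ᶜ, powKer 4 u).toReal := by
  have hK := decayConst_nonneg hG
  set c₄ : ℝ := (∫⁻ u in (ball (0 : E3) 1)ᶜ, powKer 4 u).toReal with hc₄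
  have h2ρ : ρ < 2 * ρ := by linarith
  set θ : E3 → ℝ := radialCutoff ρ (2 * ρ) with hθ
  set F : E3 → E3 := fun y ↦ (θ y * G y) • y with hF
  set I : E3 → E3 := (ball (0 : E3) ρ).indicator fun y ↦ G y • y with hI
  -- integrability
  have hθc : Continuous θ := (radialCutoff_contDiff (E' := E3) ρ (2 * ρ) (n := 0)).continuous
  have hFint : Integrable F := by
    have hF3 : IntegrableOn F (ball (0 : E3) (3 * ρ)) := by
      refine Measure.integrableOn_of_bounded measure_ball_lt_top.ne
        ((hθc.aestronglyMeasurable.mul hGm).smul aestronglyMeasurable_id) (M := K * (3 * ρ))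
        ((ae_restrict_mem measurableSet_ball).mono fun y hy ↦ ?_)
      rw [mem_ball_zero_iff] at hy
      rw [hF, norm_smul, norm_mul, Real.norm_eq_abs, Real.norm_eq_abs]
      calc |θ y| * |G y| * ‖y‖ ≤ 1 * K * (3 * ρ) :=
            mul_le_mul (mul_le_mul (abs_radialCutoff_le_one _ _ _) (abs_le_decayConst hG y)
              (abs_nonneg _) zero_le_one) hy.le (norm_nonneg _) (by rw [one_mul]; exact hK)
        _ = K * (3 * ρ) := by ring
    refine hF3.integrable_of_forall_notMem_eq_zero fun y hy ↦ ?_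
    rw [mem_ball_zero_iff, not_lt] at hy
    rw [hF]
    simp only
    rw [hθ, radialCutoff_eq_zero hρ.le h2ρ (by linarith), zero_mul, zero_smul]
  have hIint : Integrable I := (integrableOn_smul_ball hGm hG ρ).integrable_indicator measurableSet_ball
  -- pointwise bound for the difference
  have hpt : ∀ y, ENNReal.ofReal ‖I y - F y‖ ≤
      ENNReal.ofReal (2 * ρ * K) * (ball (0 : E3) ρ)ᶜ.indicator (powKer 4) y := by
    intro y
    by_cases hy : y ∈ ball (0 : E3) ρ
    · have hy' : ‖y‖ ≤ ρ := (mem_ball_zero_iff.1 hy).le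
      have h0 : I y - F y = 0 := by
        rw [hI, indicator_of_mem hy, hF]
        simp only
        rw [hθ, radialCutoff_eq_one hρ.le h2ρ hy', one_mul, sub_self]
      rw [h0, norm_zero, ENNReal.ofReal_zero]
      exact zero_le
    · rw [indicator_of_mem (mem_compl hy), hI, indicator_of_notMem hy, zero_sub, norm_neg, powKer_apply,
        ← ENNReal.ofReal_mul (by positivity)]
      refine ENNReal.ofReal_le_ofReal ?_
      have hyρ : ρ ≤ ‖y‖ := by rwa [mem_ball_zero_iff, not_lt] at hy
      have hy0 : y ≠ 0 := norm_pos_iff.1 (hρ.trans_le hyρ)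
      by_cases hy2 : 2 * ρ ≤ ‖y‖
      · rw [hF]
        simp only
        rw [hθ, radialCutoff_eq_zero hρ.le h2ρ hy2, zero_mul, zero_smul, norm_zero]
        positivity
      · rw [not_le] at hy2
        rw [hF, norm_smul, norm_mul, Real.norm_eq_abs, Real.norm_eq_abs]
        calc |θ y| * |G y| * ‖y‖ ≤ 1 * (K * ‖y‖ ^ (-4 : ℝ)) * (2 * ρ) :=
              mul_le_mul (mul_le_mul (abs_radialCutoff_le_one _ _ _) (abs_le_mul_norm_rpow hG hy0)
                (abs_nonneg _) zero_le_one) hy2.le (norm_nonneg _)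
                (by rw [one_mul]; exact mul_nonneg hK (Real.rpow_nonneg (norm_nonneg _) _))
          _ = 2 * ρ * K * ‖y‖ ^ (-4 : ℝ) := by ring
  -- integrate
  have hlint : ∫⁻ y, ENNReal.ofReal ‖I y - F y‖ ≤ ENNReal.ofReal (2 * K * c₄) := by
    calc ∫⁻ y, ENNReal.ofReal ‖I y - F y‖
        ≤ ∫⁻ y, ENNReal.ofReal (2 * ρ * K) * (ball (0 : E3) ρ)ᶜ.indicator (powKer 4) y :=
          lintegral_mono hpt
      _ = ENNReal.ofReal (2 * ρ * K) * ENNReal.ofReal (ρ⁻¹ * c₄) := by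
          rw [lintegral_const_mul _ ((measurable_powKer 4).indicator measurableSet_ball.compl),
            lintegral_indicator measurableSet_ball.compl, setLIntegral_compl_ball_powKer_four hρ]
      _ = ENNReal.ofReal (2 * K * c₄) := by
          rw [← ENNReal.ofReal_mul (by positivity)]
          congr 1
          field_simp
  have hdiff : ‖∫ y, (I y - F y)‖ ≤ 2 * K * c₄ :=
    calc ‖∫ y, (I y - F y)‖ ≤ (∫⁻ y, ENNReal.ofReal ‖I y - F y‖).toReal :=
          norm_integral_le_lintegral_norm _
      _ ≤ (ENNReal.ofReal (2 * K * c₄)).toReal := ENNReal.toReal_mono ENNReal.ofReal_ne_top hlint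
      _ = 2 * K * c₄ := ENNReal.toReal_ofReal (by have : 0 ≤ c₄ := ENNReal.toReal_nonneg; positivity)
  -- assemble
  have hrepr : ∫ y in ball (0 : E3) ρ, G y • y = (∫ y, F y) + ∫ y, (I y - F y) := by
    rw [integral_sub hIint hFint, add_sub_cancel, hI, integral_indicator measurableSet_ball]
  rw [hrepr]
  exact (norm_add_le _ _).trans (add_le_add le_rfl hdiff)

/-- **Far-field expansion, moments tested against smooth radial cutoffs**: if
`|G(y)| ≤ K(1 + |y|)⁻⁴` and `|∫ θ_ρ(y) G(y) y dy| ≤ K''` for all `ρ ≥ 1`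
(`θ_ρ = radialCutoff ρ (2ρ)`), then `∫ G(y)/|x - y| dy = (∫ G)/|x| + O(|x|⁻²)`.
[cite: SchoenYauPMT1979, Lemma 3.2, (3.12)–(3.18)] -/
theorem integral_inv_norm_sub_mul_sub_isBigO_of_radialCutoff (hGm : AEStronglyMeasurable G volume)
    (hG : ∀ y, |G y| ≤ K * (1 + ‖y‖) ^ (-4 : ℝ)) {K'' : ℝ}
    (hmom : ∀ ρ : ℝ, 1 ≤ ρ → ‖∫ y, (radialCutoff ρ (2 * ρ) y * G y) • y‖ ≤ K'') :
    (fun x : E3 ↦ (∫ y, ‖x - y‖⁻¹ * G y) - (∫ y, G y) * ‖x‖⁻¹) =O[cobounded E3]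
      fun x ↦ ‖x‖ ^ (-2 : ℝ) :=
  integral_inv_norm_sub_mul_sub_isBigO hGm hG
    (K' := K'' + 2 * K * (∫⁻ u in (ball (0 : E3) 1)ᶜ, powKer 4 u).toReal) fun ρ hρ ↦
    (norm_setIntegral_smul_le_of_radialCutoff hGm hG (by linarith)).trans
      (add_le_add (hmom ρ hρ) le_rfl)

/-! ### The crude `O(1/|x|)` bound without moment hypotheses -/

/-- **Newtonian potentials of quartically decaying densities are `O(1/|x|)`**: if
`|G(y)| ≤ K(1 + |y|)⁻⁴` then `|∫ G(y)/|x - y| dy| ≤ (2 ∫|G| + K(4c₁ + 6c₄))/|x|` for `|x| ≥ 1`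
(no moment hypothesis: on `|y| < |x|/2` the kernel difference `|1/|x - y| - 1/|x|| ≤ 2|y|/|x|²`
is at most `1/|x|`, and the far region contributes `O(|x|⁻²)` by `norm_integral_far_le`). This is
the flat form of Schoen–Yau's supremum bound `|v| ≤ c₈/r` (Comm. Math. Phys. 65 (1979), (3.9)).
[cite: SchoenYauPMT1979, Lemma 3.2, (3.5)–(3.9)] -/
theorem norm_integral_inv_norm_sub_mul_le (hGm : AEStronglyMeasurable G volume)
    (hG : ∀ y, |G y| ≤ K * (1 + ‖y‖) ^ (-4 : ℝ)) {x : E3} (hx : 1 ≤ ‖x‖) :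
    ‖∫ y, ‖x - y‖⁻¹ * G y‖ ≤
      (2 * (∫ y, |G y|) + K * (4 * (∫⁻ u in ball (0 : E3) 1, powKer 1 u).toReal +
        6 * (∫⁻ u in (ball (0 : E3) 1)ᶜ, powKer 4 u).toReal)) / ‖x‖ := by
  have hK := decayConst_nonneg hG
  set c₁ : ℝ := (∫⁻ u in ball (0 : E3) 1, powKer 1 u).toReal with hc₁
  set c₄ : ℝ := (∫⁻ u in (ball (0 : E3) 1)ᶜ, powKer 4 u).toReal with hc₄
  have hc₁0 : 0 ≤ c₁ := ENNReal.toReal_nonneg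
  have hc₄0 : 0 ≤ c₄ := ENNReal.toReal_nonneg
  set r := ‖x‖ with hr_def
  have hr : 0 < r := by linarith
  have hx0 : x ≠ 0 := norm_pos_iff.1 hr
  have hGi : Integrable G := integrable_of_decay hGm hG
  have hkG : Integrable fun y ↦ (‖x - y‖⁻¹ - r⁻¹) * G y := integrable_kernelDiff_mul hGm hG x
  set B : Set E3 := ball (0 : E3) (r / 2) with hB
  -- split `∫ G/|x - y| = ∫ (1/|x - y| - 1/r) G + (∫ G)/r`
  have hsplit : ∫ y, ‖x - y‖⁻¹ * G y =
      (∫ y in B, (‖x - y‖⁻¹ - r⁻¹) * G y) + (∫ y in Bᶜ, (‖x - y‖⁻¹ - r⁻¹) * G y) +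
        (∫ y, G y) * r⁻¹ := by
    rw [integral_add_compl measurableSet_ball hkG, ← integral_mul_const,
      ← integral_add hkG (hGi.mul_const _)]
    refine integral_congr_ae (ae_of_all _ fun y ↦ ?_)
    ring
  -- the near region, crudely
  have hnear : ‖∫ y in B, (‖x - y‖⁻¹ - r⁻¹) * G y‖ ≤ (∫ y, |G y|) / r := by
    have hpt : ∀ y ∈ B, ‖(‖x - y‖⁻¹ - r⁻¹) * G y‖ ≤ r⁻¹ * |G y| := by
      intro y hy
      rw [hB, mem_ball_zero_iff] at hy
      rw [norm_mul, Real.norm_eq_abs, Real.norm_eq_abs]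
      refine mul_le_mul_of_nonneg_right ?_ (abs_nonneg _)
      calc |‖x - y‖⁻¹ - r⁻¹| ≤ 2 * ‖y‖ / r ^ 2 := abs_inv_norm_sub_sub_inv_norm_le hx0 hy.le
        _ ≤ 2 * (r / 2) / r ^ 2 := by gcongr
        _ = r⁻¹ := by field_simp
    calc ‖∫ y in B, (‖x - y‖⁻¹ - r⁻¹) * G y‖ ≤ ∫ y in B, ‖(‖x - y‖⁻¹ - r⁻¹) * G y‖ :=
          norm_integral_le_integral_norm _
      _ ≤ ∫ y in B, r⁻¹ * |G y| :=
          setIntegral_mono_on hkG.integrableOn.norm (hGi.abs.const_mul _).integrableOn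
            measurableSet_ball hpt
      _ ≤ ∫ y, r⁻¹ * |G y| :=
          setIntegral_le_integral (hGi.abs.const_mul _)
            (ae_of_all _ fun y ↦ mul_nonneg (inv_nonneg.2 hr.le) (abs_nonneg _))
      _ = (∫ y, |G y|) / r := by rw [integral_const_mul]; ring
  have hfar := norm_integral_far_le hG hx0
  have hmono : ‖∫ y, G y‖ ≤ ∫ y, |G y| := by
    refine (norm_integral_le_integral_norm _).trans (le_of_eq ?_)
    rfl
  have hI0 : 0 ≤ ∫ y, |G y| := integral_nonneg fun y ↦ abs_nonneg _
  -- assemble, using `1/r² ≤ 1/r`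
  have hr2 : K * (4 * c₁ + 6 * c₄) / r ^ 2 ≤ K * (4 * c₁ + 6 * c₄) / r := by
    refine div_le_div_of_nonneg_left (by positivity) hr ?_
    nlinarith
  rw [hsplit]
  calc ‖(∫ y in B, (‖x - y‖⁻¹ - r⁻¹) * G y) + (∫ y in Bᶜ, (‖x - y‖⁻¹ - r⁻¹) * G y) +
        (∫ y, G y) * r⁻¹‖
      ≤ ‖∫ y in B, (‖x - y‖⁻¹ - r⁻¹) * G y‖ + ‖∫ y in Bᶜ, (‖x - y‖⁻¹ - r⁻¹) * G y‖ +
        ‖(∫ y, G y) * r⁻¹‖ := norm_add₃_le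
    _ ≤ (∫ y, |G y|) / r + K * (4 * c₁ + 6 * c₄) / r + (∫ y, |G y|) / r := by
        refine add_le_add (add_le_add hnear (hfar.trans hr2)) ?_
        rw [norm_mul, norm_inv, Real.norm_of_nonneg hr.le]
        calc ‖∫ y, G y‖ * r⁻¹ ≤ (∫ y, |G y|) * r⁻¹ := by gcongr
          _ = (∫ y, |G y|) / r := by ring
    _ = (2 * (∫ y, |G y|) + K * (4 * c₁ + 6 * c₄)) / r := by ring

/-- **`O(1/|x|)` at infinity** (big-O form of `norm_integral_inv_norm_sub_mul_le`). [folklore] -/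
theorem integral_inv_norm_sub_mul_isBigO_inv_norm (hGm : AEStronglyMeasurable G volume)
    (hG : ∀ y, |G y| ≤ K * (1 + ‖y‖) ^ (-4 : ℝ)) :
    (fun x : E3 ↦ ∫ y, ‖x - y‖⁻¹ * G y) =O[cobounded E3] fun x ↦ ‖x‖⁻¹ := by
  refine IsBigO.of_bound (2 * (∫ y, |G y|) + K * (4 * (∫⁻ u in ball (0 : E3) 1, powKer 1 u).toReal +
    6 * (∫⁻ u in (ball (0 : E3) 1)ᶜ, powKer 4 u).toReal)) ?_
  filter_upwards [eventually_cobounded_le_norm (E := E3) 1] with x hx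
  rw [norm_inv, norm_norm, ← div_eq_mul_inv]
  exact norm_integral_inv_norm_sub_mul_le hGm hG hx

end FarField

end Literature.Analysis.Potential
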